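/-
Copyright (c) 2026 the pub-hodgecm-mathlib formalisation cell (harness21).  Prover seat hodgecm-mathlib-LH4-p04 (g9), req620 Track A «(D-RAM) FOUR-FRAME» squad
((β₂) road (R-36), β₂-BOARD v2 row (L-Σ), brick (L-Σ-3B) ED. 3-1: the ABSTRACT window reduction of the diagonal row — two summand families, one guard, two boxes), 2026-09-04.
-/
import Summits.HodgeConjecture.HodgeConjecture.Theorems.F0P3cDyRamRowSumWindowArithmetic   -- ★ p862919 (this seat): `sum_filter_two_mul_eq`, `sum_range_ite_le_eq`, `sum_range_eq_sum_window`
import HarnessLib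

/-!
# Crux `H413`, line LH4 «(D-RAM) FOUR-FRAME» — (β₂) road, brick (L-Σ-3B) ED. 3-1: «THE ABSTRACT ROW-WINDOW REDUCTION» (pure `Finset` algebra over `ℤ`)

Cell `hodgecm-mathlib` (D-0151), FLOOR 0, crux item H413 = `stmt-HodgeConjecture-24833`, route of record `HCCMUnconditional`; squad F0∕P3c∕LH4; lane
`--supports stmt-HodgeConjecture-24833 --as helper` (count-neutral).  THEOREMS ONLY (no `def`, no instance, no notation, no `sorry`, default heartbeats).
WHY.  ‹ROW.letter.v1› (binder `hrow` of ★ p862801) compares, for two summand families `X_H X_A : ℕ → ℕ → ℤ` (cells `(j, b)`), the guarded sums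
`Σ_{b ∈ (Icc 1 R_t).filter (2b = m)} Σ_{j < J+1} [P j]·X_t j b` with the common guard `P j :≡ IsOrd_j lam ⟺ j ≤ jl`.  THIS FILE proves, ABSTRACTLY (no lattice, no field), that
the comparison reduces to the WINDOWED identity `Σ_{i < (jl−m)∕2+1} X_H (b+2i) b = Σ_{i < min ((jl−m)∕2+1) d} X_A (b+2i) b` at `2b = m`, `1 ≤ b`, GIVEN the window vanishings
(`j < b`; odd parity; beyond range `jl < j + b`; for `X_A` also the far cells `b + 2d ≤ j`) and the box bounds (`X_t j b ≠ 0 ⇒ b ≤ R_t` under the guard).  ED. 3 `row_of_core`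
instantiates it at the two literals of `beta2ConesB.letter.v2` (families = ★ p861305 §3's cone summands; vanishings = ‹WR›; identity = ‹CORE›).
HONEST LABEL.  Arithmetic only; nothing printed is asserted; β₂ ∕ ‹ROW› ∕ ‹CORE› stay HYPOTHESES; `HC_CM` is proved only modulo the 7 printed citations (2 remaining named inputs:
hLiu418 = `stmt-HodgeConjecture-24832`, h413 = `stmt-HodgeConjecture-24833`) until rung 0 closes.
References: [Kottwitz1986BaseChangeUnits] §1 pp. 240–241 (cell-by-cell lattice bookkeeping) · [Rogawski1990] §4.9 Prop. 4.9.1 (b) p. 55.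
-/

set_option autoImplicit false

namespace Summit.HodgeConjecture.HodgeConjecture.Cruxes.H413.F0P3cDyRamRowWindowReduction

open Finset Summit.HodgeConjecture.HodgeConjecture.Cruxes.H413.F0P3cDyRamRowSumWindowArithmetic

/-- **ONE LITERAL: THE GUARDED LEVEL SUM AT TUBE DEPTH `b = m∕2` IS ITS WINDOW SUM** (`K` cells `j = b + 2i`, `b + 2(K−1) ≤ jl`; vanishing below `b`, at odd parity,
beyond `jl − b`, and — when `K` is cut at `d` — on the far cells `b + 2d ≤ j`). [cite: Kottwitz1986BaseChangeUnits, §1 pp. 240–241] -/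
theorem sum_ite_eq_sum_window (P : ℕ → Prop) [DecidablePred P] (X : ℕ → ℕ → ℤ) {J jl m b K d : ℕ}
    (hP : ∀ j, P j ↔ j ≤ jl) (hJ : jl ≤ J) (hmjl : m ≤ jl) (hb : 2 * b = m)
    (hK : K = (jl - m) / 2 + 1 ∨ (K = min ((jl - m) / 2 + 1) d ∧ ∀ j, b + 2 * d ≤ j → (j - b) % 2 = 0 → X j b = 0))
    (h1 : ∀ j, j < b → X j b = 0) (h2 : ∀ j, b ≤ j → (j - b) % 2 = 1 → X j b = 0) (h3 : ∀ j, jl < j + b → X j b = 0) :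
    ∑ j ∈ range (J + 1), (if P j then X j b else 0) = ∑ i ∈ range K, X (b + 2 * i) b := by
  have hguard : ∑ j ∈ range (J + 1), (if P j then X j b else 0) = ∑ j ∈ range (J + 1), (if j ≤ jl then X j b else 0) :=
    sum_congr rfl fun j _ => by by_cases hj : j ≤ jl <;> simp [hj, hP j]
  have hKle : K ≤ (jl - m) / 2 + 1 := by
    rcases hK with hK | ⟨hK, -⟩
    · exact hK.le
    · rw [hK]; exact min_le_left _ _
  rw [hguard, sum_range_ite_le_eq _ hJ]
  refine sum_range_eq_sum_window (fun j => X j b) b K jl (fun i hi => by omega) fun j hj hnot => ?_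
  rcases Nat.lt_or_ge j b with hjb | hbj
  · exact h1 j hjb
  · by_cases hpar : (j - b) % 2 = 1
    · exact h2 j hbj hpar
    · -- `j = b + 2 i₀` with `i₀ = (j - b) / 2 ≥ K`
      have hi₀ : ¬ (j - b) / 2 < K := fun hlt => hnot _ hlt (by omega)
      rcases hK with hK | ⟨hK, hfar⟩
      · exact h3 j (by omega)
      · by_cases hfar' : b + 2 * d ≤ j
        · exact hfar j hfar' (by omega)
        · exact h3 j (by rw [hK] at hi₀; have := Nat.lt_min.not.1 hi₀; omega)

/-- **THE ABSTRACT ROW-WINDOW REDUCTION** — see the module docstring: two families `X_H X_A`, common guard `P j ⟺ j ≤ jl` (`jl ≤ J`, `m ≤ jl`), window vanishings, box bounds,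
and the windowed identity at every `b` with `1 ≤ b`, `2b = m` ⟹ the two filtered guarded row sums agree. [cite: Kottwitz1986BaseChangeUnits, §1 pp. 240–241] [cite: Rogawski1990, §4.9 Prop. 4.9.1 (b) p. 55] -/
theorem rowSum_eq_rowSum_of_window (P : ℕ → Prop) [DecidablePred P] (XH XA : ℕ → ℕ → ℤ) (J R R' jl m d : ℕ)
    (hP : ∀ j, P j ↔ j ≤ jl) (hJ : jl ≤ J) (hmjl : m ≤ jl)
    (h1H : ∀ b j, 1 ≤ b → 2 * b = m → j < b → XH j b = 0) (h2H : ∀ b j, 1 ≤ b → 2 * b = m → b ≤ j → (j - b) % 2 = 1 → XH j b = 0)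
    (h3H : ∀ b j, 1 ≤ b → 2 * b = m → jl < j + b → XH j b = 0) (hRH : ∀ b j, 1 ≤ b → 2 * b = m → P j → XH j b ≠ 0 → b ≤ R)
    (h1A : ∀ b j, 1 ≤ b → 2 * b = m → j < b → XA j b = 0) (h2A : ∀ b j, 1 ≤ b → 2 * b = m → b ≤ j → (j - b) % 2 = 1 → XA j b = 0)
    (h3A : ∀ b j, 1 ≤ b → 2 * b = m → jl < j + b → XA j b = 0) (h4A : ∀ b j, 1 ≤ b → 2 * b = m → b + 2 * d ≤ j → (j - b) % 2 = 0 → XA j b = 0)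
    (hRA : ∀ b j, 1 ≤ b → 2 * b = m → P j → XA j b ≠ 0 → b ≤ R')
    (hcore : ∀ b, 1 ≤ b → 2 * b = m →
      ∑ i ∈ range ((jl - m) / 2 + 1), XH (b + 2 * i) b = ∑ i ∈ range (min ((jl - m) / 2 + 1) d), XA (b + 2 * i) b) :
    ∑ b ∈ (Icc 1 R).filter (fun b => 2 * b = m), ∑ j ∈ range (J + 1), (if P j then XH j b else 0) =
      ∑ b ∈ (Icc 1 R').filter (fun b => 2 * b = m), ∑ j ∈ range (J + 1), (if P j then XA j b else 0) := by
  rw [sum_filter_two_mul_eq, sum_filter_two_mul_eq]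
  by_cases hpar : m % 2 = 0
  swap
  · rw [if_neg (fun h => hpar h.1), if_neg (fun h => hpar h.1)]
  have hb : 2 * (m / 2) = m := by omega
  by_cases hb1 : 1 ≤ m / 2
  swap
  · have hH : m / 2 ∉ Icc 1 R := fun h => hb1 (mem_Icc.1 h).1
    have hA : m / 2 ∉ Icc 1 R' := fun h => hb1 (mem_Icc.1 h).1
    rw [if_neg (fun h => hH h.2), if_neg (fun h => hA h.2)]
  -- both guarded row sums are their window sums, which agree by `hcore`
  have eH := sum_ite_eq_sum_window P XH (J := J) (d := d) hP hJ hmjl hb (Or.inl rfl)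
    (fun j hj => h1H _ j hb1 hb hj) (fun j hj hp => h2H _ j hb1 hb hj hp) (fun j hj => h3H _ j hb1 hb hj)
  have eA := sum_ite_eq_sum_window P XA (J := J) hP hJ hmjl hb (Or.inr ⟨rfl, fun j hj hp => h4A _ j hb1 hb hj hp⟩)
    (fun j hj => h1A _ j hb1 hb hj) (fun j hj hp => h2A _ j hb1 hb hj hp) (fun j hj => h3A _ j hb1 hb hj)
  have key : ∑ j ∈ range (J + 1), (if P j then XH j (m / 2) else 0) = ∑ j ∈ range (J + 1), (if P j then XA j (m / 2) else 0) := by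
    rw [eH, eA]; exact hcore _ hb1 hb
  -- outside a box the guarded row sum vanishes termwise (box bound), on either side
  have zH : m / 2 ∉ Icc 1 R → ∑ j ∈ range (J + 1), (if P j then XH j (m / 2) else 0) = 0 := fun hn =>
    sum_eq_zero fun j _ => by
      split_ifs with hp
      · by_contra hne; exact hn (mem_Icc.2 ⟨hb1, hRH _ j hb1 hb hp hne⟩)
      · rfl
  have zA : m / 2 ∉ Icc 1 R' → ∑ j ∈ range (J + 1), (if P j then XA j (m / 2) else 0) = 0 := fun hn =>
    sum_eq_zero fun j _ => by
      split_ifs with hp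
      · by_contra hne; exact hn (mem_Icc.2 ⟨hb1, hRA _ j hb1 hb hp hne⟩)
      · rfl
  by_cases hH : m / 2 ∈ Icc 1 R <;> by_cases hA : m / 2 ∈ Icc 1 R'
  · rw [if_pos ⟨hpar, hH⟩, if_pos ⟨hpar, hA⟩]; exact key
  · rw [if_pos ⟨hpar, hH⟩, if_neg (fun h => hA h.2), key]; exact zA hA
  · rw [if_neg (fun h => hH h.2), if_pos ⟨hpar, hA⟩, ← key]; exact (zH hH).symm
  · rw [if_neg (fun h => hH h.2), if_neg (fun h => hA h.2)]

end Summit.HodgeConjecture.HodgeConjecture.Cruxes.H413.F0P3cDyRamRowWindowReduction
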